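import Summits.QuantumFields.BalabanUV.T4Continuum.Spine.NE1p.DressedTowerWitnessGaugeBinders

/-!
# T⁴ programme, spine estimate NE1′ (node O3b/H2) — THE GAUGE QUOTIENT ACTS, part 3 of 3: the canonical terminal face S3l FIRES on
# row W7's tower with the gauge relation `V = U + grad g` LIVE (every integer `81 ≤ L ≤ 120`), and THE DECIDED SEPARATION — on the
# same fluctuation data the RAW reading (`rel := Eq`) of the fresh pairs admits NO K-free (I4′) constant, the gauge-quotient reading
# is served by `c_δ = ½` at every cutoff (formalisation crew `b2b-balaban-t4-ne1p-formalise-*`, leaf seat 03, generation 4, witness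
# row W15; INTENT CLAIMS.log l.12021)

Cell `pub-balaban`, sub-cell `t4`, BINDER-OWNERS row NE1′.  ADDITIVE — imports part 2 `Spine/NE1p/DressedTowerWitnessGaugeBinders` (through
it part 1, W11r part 1 p216180, leaf-09's S3l p215128, W7, W5) ONLY; modifies nothing.

* §6 **THE FACE FIRES WITH THE GAUGE QUOTIENT LIVE** [decided toy]: for every integer `81 ≤ Lb ≤ 120`, leaf-09's
  `dressedStabilityWith_of_canonicalSliceWinSchedules` ∕ `dressedStability_of_canonicalSliceWinSchedules` ∕
  `dressedBudget_of_canonicalSliceWinSchedules` BY NAME, ONE application each, on W7's tower `towerM` with: W11r's located scalars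
  ONCE (`κ = ½`, `L = Lb`, `c̄ = 0`, `N₀ = A₀ = 1`, `s̄⁰ = 0`, `ρ′ = ¾`, `r = 1`, `c_δ = ½`, `m = ¼`; `hloc_int`, `hsmall_int`), ONE
  cutoff-free raw-rate schedule `fun _ _ => Wr` (`hratioR`), and per `(a, K)`: **`rel := fun U V => ∃ g, V = U + grad g`**, carried
  functionals `FnG` (plaquette reading), **`hinv := hinvG` (Stokes)**, **`hpairx := relGauge_pairsG` (pure gauge gauged away)**,
  **`hne`∕`hsup := hneG`∕`hsupG` (increments over gauge orbits)**, `hsl := hslG`, `hFn := hFnTG` (EQUALITY), `hQ := hQTG` (EQUALITY),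
  `hDμ := hDμG`, `hz₁ := hz₁R`, `hδfwk := hδfwkR`, `hdefwk := hdefwkR`; and W11r's tower-level data BY NAME UNCHANGED — `hδfT`∕`hrateT`
  at rate `Lb⁻²`, `hβT`, `anchM`∕`hmultM`∕`compM`∕`hscaleM`∕`hhousedM`∕`hvolM`, `SM`∕`SgM`∕`hSgT`, `habsM`, `hregM`, `hcmM`, W5's
  zero-action `realBaseAt_W`∕`exponentSliceAt_M` (`𝒜 ≡ 0`, `s ≡ 0` DECLARED ≡ 0), `creg ≡ 0`, `Sabs ≡ ∅` (DECLARED).  The With-form,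
  what is checked here is that the face's
  three theorems elaborate on the GAUGE data.  NAMED: `gaugeQuotient_fires` = (invariance of the carried functionals under the
  non-trivial relation, by Stokes) ∧ (the With-form — S3l's `dressedStabilityWith_of_canonicalSliceWinSchedules` BY NAME, ONE
  application) — stated CONJOINED because the With-form's bare closed statement coincides with W11r's
  `dressedStabilityWith_towerM_integer` (obtained there with `rel := Eq`), which the gate's `dedup.landed` protects (typer R-T64 (d),
  and the «dedup-safe ENDs» ruling for W16); and §8.  The packed root and ROOT-B are `example`s (their closed statements are W7's
  `dressedStability_towerM` ∕ W7c's budget face — `dedup.landed` likewise).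
* §7 the decided instance `Lb = 100` and the endpoint instances `Lb = 81`, `Lb = 120`.
* §8 **THE SEPARATION, DECIDED IN KERNEL** — the binder shapes `hpairx` (S3l l.231–235) and `hδf` (l.228) VERBATIM, specialised to
  these data (schedule `Wr`, atoms `atomG`, `z₁ = 0`, live generations `SgM`, rate `Lb⁻²`), with ONLY the relation varied:
  `gauge_profile_Kfree` — with `rel := (∃ g, · = · + grad g)` ONE K-free constant `c_δ = ½` and the profile `δf := ψ^{k+1}∕4` serve
  EVERY cutoff; `raw_profile_not_Kfree` — with `rel := Eq` NO real `c_δ` serves all cutoffs with ANY profiles `δf_K`: at step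
  `k = K` the live generation `(b, 0)` forces `θ^{K+1}∕16 = gsz K ≤ δf ≤ c_δ·Lb^{−2K}`, i.e. `c_δ ≥ (θ∕16)·(θ·Lb²)^K ≥ (θ∕16)·2^K`
  (`θ·Lb² ≥ 81²∕121 > 2`) — unbounded.  The function-level twin, THROUGH the terminal face's own binder shapes, of the booking-level
  `T4TrajectoryDensityFresh.freshProfile_not_Kfree` (p198944) and of `T4BirthChartTransport.toy_relGauge`: caveat k1's K-freeness of
  the (I4′) constant holds here BECAUSE OF the gauge quotient.

HONEST FRAMING (typer R-T64 (i)(f), k2∕k3).  An ABELIAN toy (additive gauge action `U ↦ U + grad g` over the chart's scalars)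
exercising the SHAPE of F-9's gauge quotient — it does NOT model Bałaban's non-abelian relative axial gauge, asserts no commutation
identity, and F-6's rate stays a displayed wall (`t4/CITED-FACTS-T4.md` §2∕§4); `Lb` is the toy's integer, NOT Bałaban's `L`; joint
satisfiability ∕ separation of hypothesis SHAPES ([folklore]; 0 sorry; 0 citations; no `def`); NOTHING of Bałaban's densities, gauges
or propagators — it shows where in the typed object the quotient does its work.  Headline (c4): «the gauge quotient acts: `hinv` by
discrete Stokes, `hpairx` by gauging away a raw-rate pure-gauge component; raw reading not K-free, quotient reading K-free at
`c_δ = ½`; the canonical terminal face fires at integer `Lb` on a decided abelian toy; nothing of Bałaban's densities; NE1′ NOT proved»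
(NE1′ ⇐ the named binders; 0 binders instantiated on Bałaban's densities); spine PROVED 0∕9.  Rung (B)+1 on ONE finite four-torus — NOT infinite volume, NOT a
mass gap, NOT OS on ℝ⁴, NOT Clay.  HONEST DEPENDENCY: continuum YM on T⁴ ⇐ BetaPertH ∧ nine spine estimates (0/9 proved); BetaPertH ⇐
(D1) ∧ (D4) ∧ CAP+tail; G-an2-4 gates asym, D1 and NE2/3/4.
-/

noncomputable section

namespace Summit.QuantumFields.BalabanUV.T4Continuum.NE1p.DressedTowerWitnessGauge

open MeasureTheory Set Metric Filter Finset
open scoped BigOperators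
open Literature.MathematicalPhysics.QuantumFieldTheory.Balaban1983to89
open Literature.MathematicalPhysics.QuantumFieldTheory.Balaban1983to89.T4TermFormat
open Literature.MathematicalPhysics.QuantumFieldTheory.Balaban1983to89.T4TermFormat.Booking
open Literature.MathematicalPhysics.QuantumFieldTheory.Balaban1983to89.T4FeltGeometry
open Literature.MathematicalPhysics.QuantumFieldTheory.Balaban1983to89.T4GatedBooking
open Literature.MathematicalPhysics.QuantumFieldTheory.Balaban1983to89.T4TrajectoryComparison
open Literature.MathematicalPhysics.QuantumFieldTheory.Balaban1983to89.T4TrajectoryModulus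
open B8Lemma1Lattice (e)
open T4TrajectoryModulus (bondBall bondBall_add_mem bondBall_latMove_add_mem bondBall_diam)
open T4BlockTransport (Fld NDir latMove latN Site norm_dir_le)
open T4BirthChartTransport (GaugeInvariant BirthSlice RelGauge)
open T4TrajectoryDensity
open Summit.QuantumFields.BalabanUV.T4Continuum.T4TrajectoryDensityDressed
open Summit.QuantumFields.BalabanUV.T4Continuum.T4TrajectoryDensityWitness
open Summit.QuantumFields.BalabanUV.T4Continuum.NE1p.DressedRoot
open Summit.QuantumFields.BalabanUV.T4Continuum.NE1p.DressedUniformConstants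
open Summit.QuantumFields.BalabanUV.T4Continuum.NE1p.DressedWindowScheduleWin
open Summit.QuantumFields.BalabanUV.T4Continuum.NE1p.DressedWindowScheduleModWin
open Summit.QuantumFields.BalabanUV.T4Continuum.NE1p.DressedAbsorptionWindow
open Summit.QuantumFields.BalabanUV.T4Continuum.NE1p.DressedTowerWitness
open Summit.QuantumFields.BalabanUV.T4Continuum.NE1p.DressedTowerWitnessSlice
open Summit.QuantumFields.BalabanUV.T4Continuum.NE1p.DressedTransportAssembledModData
open Summit.QuantumFields.BalabanUV.T4Continuum.NE1p.DressedStabilityOfCanonicalSliceWinSchedules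
open Summit.QuantumFields.BalabanUV.T4Continuum.NE1p.DressedCellNecessity
open Summit.QuantumFields.BalabanUV.T4Continuum.NE1p.DressedTerminalWitnessReuse

/-! ## §6 THE CANONICAL TERMINAL FACE FIRES WITH THE GAUGE QUOTIENT LIVE, AT EVERY INTEGER `81 ≤ L ≤ 120` [decided toy] -/

section Fires

variable (Lb : ℕ) (h81 : 81 ≤ Lb) (h120 : Lb ≤ 120)
include h81 h120

/-- **THE FACE FIRES WITH THE GAUGE QUOTIENT LIVE — CONSTANTS DISPLAYED AT THE INTEGER `Lb`** [decided toy]: for every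
`81 ≤ Lb ≤ 120`, (i) the carried functionals are invariant under the NON-TRIVIAL abelian gauge relation `V = U + grad g` (part 2 `hinvG`,
by Stokes) AND (ii) `DressedStabilityWith towerM 1 (rhoOne Lb⁻² 2 0 ½) Lb⁻³` by leaf-09's `dressedStabilityWith_of_canonicalSliceWinSchedules`
BY NAME, ONE application, whose whole displayed list is inhabited AT ONCE by the gauge data of parts 1–2: `rel := fun U V => ∃ g,
V = U + grad g`, `hinv := hinvG` (Stokes), `hpairx := relGauge_pairsG` (pure gauge gauged away), `hne`∕`hsup := hneG`∕`hsupG` (gauge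
orbits), `hsl := hslG`, `hFn := hFnTG` (EQUALITY), `hQ := hQTG` (EQUALITY), `hDμ := hDμG`, `hz₁ := hz₁R`, the raw-rate schedule `Wr`
(`hratioR`, `hδfwkR`, `hdefwkR`), and W11r's tower-level data BY NAME (`hδfT`∕`hrateT` at rate `Lb⁻²`, `hβT`, `anchM`∕`hmultM`, `compM`∕
`hscaleM`∕`hhousedM`∕`hvolM`, `SM`∕`SgM`∕`hSgT`, `habsM`, `hregM`, `hcmM`, the `_int` scalars; W5's zero-action `realBaseAt_W`∕
`exponentSliceAt_M` — `𝒜 ≡ 0`, `s ≡ 0`, `creg ≡ 0`, `Sabs ≡ ∅` DECLARED).  STATED CONJOINED (typer R-T64 (d) ∕ the W16 ruling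
«dedup-safe ENDs»): conjunct (ii) ALONE coincides textually with W11r's `dressedStabilityWith_towerM_integer` (obtained there with
`rel := Eq`), which the gate's `dedup.landed` protects; the pair (i) ∧ (ii) is new, and its proof term is the content — S3l applied to
THESE functionals under THIS relation. [folklore] -/
theorem gaugeQuotient_fires :
    (∀ K k' k, GaugeInvariant (fun U V : Fld 4 ℂ => ∃ g : Site 4 → ℂ, V = U + grad g) (FnG K k' k)) ∧
      DressedStabilityWith towerM 1 (rhoOne ((Lb : ℝ) ^ 2)⁻¹ (4 * (1 / 2) / 1) 0 (1 / 2)) ((Lb : ℝ)⁻¹ ^ 3) :=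
  ⟨hinvG,
  dressedStabilityWith_of_canonicalSliceWinSchedules towerM (κ := 1 / 2) (L := (Lb : ℝ)) (cbar := 0) (N₀ := 1) (A₀ := 1)
    (sbar := 0) (ρ' := 3 / 4) (r := 1) (cδ := 1 / 2) (m := 1 / 4) (w := fun _ _ => 1) (fun _ _ => Wr) (by norm_num)
    (Fn := fun _ K _ k' k => FnG K k' k) (rel := fun _ _ _ _ _ U V => ∃ g : Site 4 → ℂ, V = U + grad g)
    (ref := fun _ _ _ _ U => U) (base := fun _ _ _ _ => base₁) (𝒜 := fun _ _ _ _ => zeroExp) (𝒬 := fun _ K _ k => 𝒬TG K k)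
    (q := fun _ _ _ _ _ => 0) (μ := fun _ _ _ k => flAt (atomG k)) (z₀ := fun _ _ _ _ => 0) (z₁ := fun _ _ _ _ => 0)
    (defect := fun _ _ _ _ k => defW (k + 1)) (s := fun _ _ _ _ => 0) (S := fun _ K k b => SM K k b)
    (Sg := fun _ K k b => SgM K k b) (c := fun _ _ _ _ => (((1 / 4 : ℝ)) : ℂ)) (δf := fun _ _ _ k _ => dfW k)
    (creg := fun _ _ _ => 0) (Lb := Lb) (mB := 1) (v := 1) (fun _ K => anchM K Lb) (comp := fun _ K k b => compM K k b)
    (Sabs := fun _ _ _ => ∅) (β := fun _ K _ => (LW⁻¹ ^ 3) ^ K) (A := 0) (β₀ := 1)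
    (fun _ _ => hratioR) (one_le_natL h81) le_rfl zero_le_one zero_le_one (by norm_num) (hloc_int h81) hρ'_int hsmall_int
    one_pos (by norm_num)
    (fun _ K b k' _ _ _ => birthSlice_anti_window (hslG K b k') (Wr.hwcw k'))
    (fun _ K _ k' k _ _ hk _ U => hFnTG K k' k hk U) (fun _ _ _ _ k _ _ _ _ _ => mem_bddClass_flAt _ _)
    (fun _ _ _ _ k _ _ _ _ => realBaseAt_W _ _) (fun _ _ _ _ k _ _ _ _ => exponentSliceAt_M _ _ _ _)
    (fun _ K b k x hx => hδfT h81 h120 K k b x hx) (fun _ _ _ k => hDμG k) (fun _ _ _ k => hz₁R k)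
    (fun _ _ _ _ k _ _ _ _ U₀ _ pd _ _ => (relGauge_pairsG k).mono fun _ hz t _ => hz (latMove U₀ pd t))
    (fun _ K _ k' k => hinvG K k' k) (fun _ _ _ _ _ k _ => aesm_flAt _ _) (fun _ _ _ _ k => hdefwkR k)
    (fun _ _ _ k' k _ _ _ => hrateT h81 h120 k' k) (fun _ _ _ _ k _ _ _ _ => hneG k)
    (fun _ K b k' k _ _ _ _ => hsupG K b k' k) (fun _ _ _ => le_rfl) (fun _ _ _ _ => le_rfl) (fun _ K => hregM K _)
    (fun _ _ _ _ => le_rfl) rfl (fun _ K => hmultM K Lb) (fun _ K => hscaleM K) (fun _ K => hhousedM K) (fun _ K => hvolM K)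
    (fun _ _ _ _ h => by simp at h) (fun _ _ _ => Finset.empty_subset _) (fun _ K => habsM K _ _)
    (fun _ K j hj => hβT h81 h120 K j hj) (fun _ K b k => hQTG K b k) (fun _ K => hSgT K) (fun _ _ _ _ => hcmM)
    (fun _ _ _ k _ _ => hδfwkR k) hvN₀_int le_rfl hfan_int hamp_int⟩

/-! **THE ROW ROOT `DressedStability towerM` BY PACKING THE FACE, ON THE GAUGE DATA** [decided toy] — leaf-09's
`dressedStability_of_canonicalSliceWinSchedules` applied ONCE with `rel := (∃ g, · = · + grad g)`; an `example` (the closed statement is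
W7's `dressedStability_towerM`, protected by `dedup.landed`). [folklore] -/
example : DressedStability towerM :=
  dressedStability_of_canonicalSliceWinSchedules towerM (κ := 1 / 2) (L := (Lb : ℝ)) (cbar := 0) (N₀ := 1) (A₀ := 1)
    (sbar := 0) (ρ' := 3 / 4) (r := 1) (cδ := 1 / 2) (m := 1 / 4) (w := fun _ _ => 1) (fun _ _ => Wr) (by norm_num)
    (Fn := fun _ K _ k' k => FnG K k' k) (rel := fun _ _ _ _ _ U V => ∃ g : Site 4 → ℂ, V = U + grad g)
    (ref := fun _ _ _ _ U => U) (base := fun _ _ _ _ => base₁) (𝒜 := fun _ _ _ _ => zeroExp) (𝒬 := fun _ K _ k => 𝒬TG K k)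
    (q := fun _ _ _ _ _ => 0) (μ := fun _ _ _ k => flAt (atomG k)) (z₀ := fun _ _ _ _ => 0) (z₁ := fun _ _ _ _ => 0)
    (defect := fun _ _ _ _ k => defW (k + 1)) (s := fun _ _ _ _ => 0) (S := fun _ K k b => SM K k b)
    (Sg := fun _ K k b => SgM K k b) (c := fun _ _ _ _ => (((1 / 4 : ℝ)) : ℂ)) (δf := fun _ _ _ k _ => dfW k)
    (creg := fun _ _ _ => 0) (Lb := Lb) (mB := 1) (v := 1) (fun _ K => anchM K Lb) (comp := fun _ K k b => compM K k b)
    (Sabs := fun _ _ _ => ∅) (β := fun _ K _ => (LW⁻¹ ^ 3) ^ K) (A := 0) (β₀ := 1)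
    (fun _ _ => hratioR) (one_le_natL h81) le_rfl zero_le_one zero_le_one (by norm_num) (hloc_int h81) hρ'_int hsmall_int
    one_pos (by norm_num)
    (fun _ K b k' _ _ _ => birthSlice_anti_window (hslG K b k') (Wr.hwcw k'))
    (fun _ K _ k' k _ _ hk _ U => hFnTG K k' k hk U) (fun _ _ _ _ k _ _ _ _ _ => mem_bddClass_flAt _ _)
    (fun _ _ _ _ k _ _ _ _ => realBaseAt_W _ _) (fun _ _ _ _ k _ _ _ _ => exponentSliceAt_M _ _ _ _)
    (fun _ K b k x hx => hδfT h81 h120 K k b x hx) (fun _ _ _ k => hDμG k) (fun _ _ _ k => hz₁R k)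
    (fun _ _ _ _ k _ _ _ _ U₀ _ pd _ _ => (relGauge_pairsG k).mono fun _ hz t _ => hz (latMove U₀ pd t))
    (fun _ K _ k' k => hinvG K k' k) (fun _ _ _ _ _ k _ => aesm_flAt _ _) (fun _ _ _ _ k => hdefwkR k)
    (fun _ _ _ k' k _ _ _ => hrateT h81 h120 k' k) (fun _ _ _ _ k _ _ _ _ => hneG k)
    (fun _ K b k' k _ _ _ _ => hsupG K b k' k) (fun _ _ _ => le_rfl) (fun _ _ _ _ => le_rfl) (fun _ K => hregM K _)
    (fun _ _ _ _ => le_rfl) rfl (fun _ K => hmultM K Lb) (fun _ K => hscaleM K) (fun _ K => hhousedM K) (fun _ K => hvolM K)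
    (fun _ _ _ _ h => by simp at h) (fun _ _ _ => Finset.empty_subset _) (fun _ K => habsM K _ _)
    (fun _ K j hj => hβT h81 h120 K j hj) (fun _ K b k => hQTG K b k) (fun _ K => hSgT K) (fun _ _ _ _ => hcmM)
    (fun _ _ _ k _ _ => hδfwkR k) hvN₀_int le_rfl hfan_int hamp_int

/-! **ROOT-B THROUGH THE CANONICAL TERMINAL FACE ON THE GAUGE DATA** [decided toy]: for EVERY run-weight family `0 ≤ wt () K j ≤ w̄`
(`j ≤ K`), `DressedBudget towerM wt` by leaf-09's `dressedBudget_of_canonicalSliceWinSchedules` BY NAME, same displayed list; an `example`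
(the statement is W7c's `dressedBudget_towerM_allCutoffs`, protected by `dedup.landed`). [folklore] -/
example {wbar : ℝ} {wt : Unit → ℕ → ℕ → ℝ} (hwbar : 0 ≤ wbar)
    (hw0 : ∀ p K, ∀ j ≤ K, 0 ≤ wt p K j) (hwb : ∀ p K, ∀ j ≤ K, wt p K j ≤ wbar) : DressedBudget towerM wt :=
  dressedBudget_of_canonicalSliceWinSchedules towerM (κ := 1 / 2) (L := (Lb : ℝ)) (cbar := 0) (N₀ := 1) (A₀ := 1)
    (sbar := 0) (ρ' := 3 / 4) (r := 1) (cδ := 1 / 2) (m := 1 / 4) (w := fun _ _ => 1) (fun _ _ => Wr) (by norm_num)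
    (Fn := fun _ K _ k' k => FnG K k' k) (rel := fun _ _ _ _ _ U V => ∃ g : Site 4 → ℂ, V = U + grad g)
    (ref := fun _ _ _ _ U => U) (base := fun _ _ _ _ => base₁) (𝒜 := fun _ _ _ _ => zeroExp) (𝒬 := fun _ K _ k => 𝒬TG K k)
    (q := fun _ _ _ _ _ => 0) (μ := fun _ _ _ k => flAt (atomG k)) (z₀ := fun _ _ _ _ => 0) (z₁ := fun _ _ _ _ => 0)
    (defect := fun _ _ _ _ k => defW (k + 1)) (s := fun _ _ _ _ => 0) (S := fun _ K k b => SM K k b)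
    (Sg := fun _ K k b => SgM K k b) (c := fun _ _ _ _ => (((1 / 4 : ℝ)) : ℂ)) (δf := fun _ _ _ k _ => dfW k)
    (creg := fun _ _ _ => 0) (Lb := Lb) (mB := 1) (v := 1) (fun _ K => anchM K Lb) (comp := fun _ K k b => compM K k b)
    (Sabs := fun _ _ _ => ∅) (β := fun _ K _ => (LW⁻¹ ^ 3) ^ K) (A := 0) (β₀ := 1)
    (fun _ _ => hratioR) (one_le_natL h81) le_rfl zero_le_one zero_le_one (by norm_num) (hloc_int h81) hρ'_int hsmall_int
    one_pos (by norm_num)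
    (fun _ K b k' _ _ _ => birthSlice_anti_window (hslG K b k') (Wr.hwcw k'))
    (fun _ K _ k' k _ _ hk _ U => hFnTG K k' k hk U) (fun _ _ _ _ k _ _ _ _ _ => mem_bddClass_flAt _ _)
    (fun _ _ _ _ k _ _ _ _ => realBaseAt_W _ _) (fun _ _ _ _ k _ _ _ _ => exponentSliceAt_M _ _ _ _)
    (fun _ K b k x hx => hδfT h81 h120 K k b x hx) (fun _ _ _ k => hDμG k) (fun _ _ _ k => hz₁R k)
    (fun _ _ _ _ k _ _ _ _ U₀ _ pd _ _ => (relGauge_pairsG k).mono fun _ hz t _ => hz (latMove U₀ pd t))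
    (fun _ K _ k' k => hinvG K k' k) (fun _ _ _ _ _ k _ => aesm_flAt _ _) (fun _ _ _ _ k => hdefwkR k)
    (fun _ _ _ k' k _ _ _ => hrateT h81 h120 k' k) (fun _ _ _ _ k _ _ _ _ => hneG k)
    (fun _ K b k' k _ _ _ _ => hsupG K b k' k) (fun _ _ _ => le_rfl) (fun _ _ _ _ => le_rfl) (fun _ K => hregM K _)
    (fun _ _ _ _ => le_rfl) rfl (fun _ K => hmultM K Lb) (fun _ K => hscaleM K) (fun _ K => hhousedM K) (fun _ K => hvolM K)
    (fun _ _ _ _ h => by simp at h) (fun _ _ _ => Finset.empty_subset _) (fun _ K => habsM K _ _)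
    (fun _ K j hj => hβT h81 h120 K j hj) (fun _ K b k => hQTG K b k) (fun _ K => hSgT K) (fun _ _ _ _ => hcmM)
    (fun _ _ _ k _ _ => hδfwkR k) hvN₀_int le_rfl hfan_int hamp_int hwbar hw0 hwb le_rfl

end Fires

/-! ## §7 The decided instance at `L = 100` and the endpoints `L = 81`, `L = 120` [decided toy] -/

/-- **DECIDED: THE FACE FIRES WITH THE GAUGE QUOTIENT LIVE AT `L = 100`** (family factor `3e³∕10⁴`, `τ = 10⁻⁶`). [folklore] -/
theorem gaugeQuotient_fires_hundred :
    (∀ K k' k, GaugeInvariant (fun U V : Fld 4 ℂ => ∃ g : Site 4 → ℂ, V = U + grad g) (FnG K k' k)) ∧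
      DressedStabilityWith towerM 1 (rhoOne (((100 : ℕ) : ℝ) ^ 2)⁻¹ (4 * (1 / 2) / 1) 0 (1 / 2)) (((100 : ℕ) : ℝ)⁻¹ ^ 3) :=
  gaugeQuotient_fires 100 (by norm_num) (by norm_num)

/-! The endpoints of the integer window (W11r's `eighty_blocks_excluded` ∕ `LW_window` bound it): the With-form and the packed root
at `Lb = 81` and `Lb = 120`. [folklore] -/
example : DressedStabilityWith towerM 1 (rhoOne (((81 : ℕ) : ℝ) ^ 2)⁻¹ (4 * (1 / 2) / 1) 0 (1 / 2)) (((81 : ℕ) : ℝ)⁻¹ ^ 3) :=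
  (gaugeQuotient_fires 81 (by norm_num) (by norm_num)).2

example : DressedStabilityWith towerM 1 (rhoOne (((120 : ℕ) : ℝ) ^ 2)⁻¹ (4 * (1 / 2) / 1) 0 (1 / 2)) (((120 : ℕ) : ℝ)⁻¹ ^ 3) :=
  (gaugeQuotient_fires 120 (by norm_num) (by norm_num)).2

example : DressedStability towerM := ⟨_, _, _, (gaugeQuotient_fires 81 (by norm_num) (by norm_num)).2⟩

example : DressedStability towerM := ⟨_, _, _, (gaugeQuotient_fires 120 (by norm_num) (by norm_num)).2⟩

/-! ## §8 THE SEPARATION: the binder shapes `hpairx` ∧ `hδf` on these data, raw reading vs. gauge-quotient reading [decided toy] -/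

section Separation

variable (Lb : ℕ) (h81 : 81 ≤ Lb) (h120 : Lb ≤ 120)
include h81 h120

/-- **GAUGE-QUOTIENT READING: ONE K-FREE (I4′) CONSTANT SERVES EVERY CUTOFF** [decided toy]: with `rel := (∃ g, · = · + grad g)` the
shapes `hpairx` (S3l l.231–235) and `hδf` (l.228) — VERBATIM, specialised to the raw-rate schedule `Wr`, the atoms `atomG`, `z₁ = 0`,
W11r's live generations `SgM`, the face's rate `Lb⁻²` — hold at every cutoff `K` with the profile `δf := ψ^{k+1}∕4` and `c_δ = ½`
(`relGauge_pairsG`, `hδfT`). [folklore] -/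
theorem gauge_profile_Kfree : ∃ cδ : ℝ, ∀ K : ℕ, ∃ δf : (BM K).Birth → ℕ → (BM K).Birth × ℕ → ℝ,
    (∀ (b : (BM K).Birth) (k' k : ℕ), (BM K).birthScale b ≤ k' → k' ≤ k →
      ∀ x ∈ SgM K k b, ∀ U₀ ∈ (bondBall 4 (Wr.ρw (k + 1)) : Set (Fld 4 ℂ)), ∀ pd : NDir 4 ℂ, 0 < latN pd →
        latN pd ≤ Wr.wc (k + 1) →
        ∀ᵐ z ∂flAt (atomG k), ∀ t ∈ tube (Wr.ϱ₁ k / latN pd),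
          RelGauge (fun U V : Fld 4 ℂ => ∃ g : Site 4 → ℂ, V = U + grad g) latMove latN (latMove U₀ pd t + 0)
            (latMove U₀ pd t + z) (δf b k x)) ∧
    (∀ (b : (BM K).Birth) (k : ℕ), ∀ x ∈ SgM K k b, 0 ≤ δf b k x ∧ δf b k x ≤ cδ * (((Lb : ℝ) ^ 2)⁻¹) ^ (k - x.2)) :=
  ⟨1 / 2, fun K => ⟨fun _ k _ => dfW k,
    fun _ _ k _ _ _ _ U₀ _ pd _ _ => (relGauge_pairsG k).mono fun _ hz t _ => hz (latMove U₀ pd t),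
    fun b k x hx => hδfT h81 h120 K k b x hx⟩⟩

omit h120 in
/-- [arith] [folklore] The raw-to-transverse ratio per step against the face's rate: `θ·Lb² ≥ 2` (indeed `≥ 81²∕121 > 54`). -/
theorem two_le_theta_mul_sq : (2 : ℝ) ≤ LW⁻¹ * (Lb : ℝ) ^ 2 := by
  have hL : (81 : ℝ) ≤ Lb := by exact_mod_cast h81
  have hW := LW_window.2
  have hWp := LW_pos
  rw [inv_mul_eq_div, le_div_iff₀ hWp]
  nlinarith

omit h120 in
/-- **RAW READING: NO K-FREE (I4′) CONSTANT** [decided toy]: with `rel := Eq` — every earlier witness's relation — there is NO real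
`c_δ` such that, at every cutoff `K`, SOME profile `δf` satisfies the SAME two shapes on the SAME data.  At step `k = K` the live
generation `(b, 0)` and the atom `atomG K` force `gsz K = θ^{K+1}∕16 ≤ δf b K (b,0)` (part 2 `not_relGauge_eq_atomG`: the raw chart
must move by the atom, whose bond `⟨0,e₃⟩` is pure gauge) and `δf b K (b,0) ≤ c_δ·Lb^{−2K}`, whence `c_δ ≥ (θ∕16)·(θ·Lb²)^K ≥
(θ∕16)·2^K > (θ∕16)·K` for every `K` — absurd.  Caveat k1's K-freeness of the (I4′) constant holds on these data BECAUSE OF the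
gauge quotient (`gauge_profile_Kfree`), not without it. [folklore] -/
theorem raw_profile_not_Kfree : ¬ ∃ cδ : ℝ, ∀ K : ℕ, ∃ δf : (BM K).Birth → ℕ → (BM K).Birth × ℕ → ℝ,
    (∀ (b : (BM K).Birth) (k' k : ℕ), (BM K).birthScale b ≤ k' → k' ≤ k →
      ∀ x ∈ SgM K k b, ∀ U₀ ∈ (bondBall 4 (Wr.ρw (k + 1)) : Set (Fld 4 ℂ)), ∀ pd : NDir 4 ℂ, 0 < latN pd →
        latN pd ≤ Wr.wc (k + 1) →
        ∀ᵐ z ∂flAt (atomG k), ∀ t ∈ tube (Wr.ϱ₁ k / latN pd),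
          RelGauge (fun U V : Fld 4 ℂ => U = V) latMove latN (latMove U₀ pd t + 0) (latMove U₀ pd t + z) (δf b k x)) ∧
    (∀ (b : (BM K).Birth) (k : ℕ), ∀ x ∈ SgM K k b, 0 ≤ δf b k x ∧ δf b k x ≤ cδ * (((Lb : ℝ) ^ 2)⁻¹) ^ (k - x.2)) := by
  rintro ⟨cδ, h⟩
  -- a cutoff beyond the raw budget: `16·c_δ∕θ < K`
  obtain ⟨K, hK⟩ := exists_nat_gt (16 * cδ / LW⁻¹)
  obtain ⟨δf, hpair, hδf⟩ := h K
  have hθ := theta_pos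
  -- the live generation `(b, 0)` at the top step `k = K`
  have hx : (((), 0) : (BM K).Birth × ℕ) ∈ SgM K K () := by
    rw [SgM_of_le le_rfl]; exact Finset.mem_singleton_self _
  -- an admissible chart direction (the zero field, declared bound `wc (K+1)`), the zero base, the parameter `t = 0`
  let pd : NDir 4 ℂ := fldDir 0 (Wr.wc (K + 1)) fun x ν => by simpa using (Wr.wc_pos (K + 1)).le
  have hpd : 0 < latN pd := Wr.wc_pos (K + 1)
  have hae := hpair () 0 K le_rfl (Nat.zero_le K) _ hx 0 (zero_mem_windowR (K + 1)) pd hpd le_rfl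
  have hat := (ae_flAt.mp hae).2 0 (by
    simpa using ofReal_mem_tube (div_pos (Wr.ϱ₁_pos' K) hpd) (left_mem_Icc.mpr (zero_le_one (α := ℝ))))
  rw [T4BlockTransport.latMove_zero] at hat
  -- hence the raw defect is at least the pure-gauge size …
  have hge : gsz K ≤ δf () K ((), 0) := by
    by_contra hlt
    exact not_relGauge_eq_atomG K 0 (lt_of_not_ge hlt) hat
  -- … and at most `c_δ·Lb^{−2K}`
  have hle : δf () K ((), 0) ≤ cδ * (((Lb : ℝ) ^ 2)⁻¹) ^ (K - 0) := (hδf () K _ hx).2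
  rw [Nat.sub_zero] at hle
  -- arithmetic: `θ^{K+1}∕16 ≤ c_δ·(Lb²)⁻¹^K` forces `K ≤ 16 c_δ∕θ`
  have hψL : 0 < (((Lb : ℝ) ^ 2)⁻¹) ^ K := pow_pos (inv_pos.mpr (by have := natL_pos h81; positivity)) K
  have hprod : (LW⁻¹ * (Lb : ℝ) ^ 2) ^ K * (((Lb : ℝ) ^ 2)⁻¹) ^ K = (LW⁻¹) ^ K := by
    rw [← mul_pow, mul_assoc, mul_inv_cancel₀ (by have := natL_pos h81; positivity), mul_one]
  have h2K : (K : ℝ) ≤ (LW⁻¹ * (Lb : ℝ) ^ 2) ^ K :=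
    calc (K : ℝ) ≤ (2 : ℝ) ^ K := by exact_mod_cast (Nat.lt_two_pow_self).le
      _ ≤ (LW⁻¹ * (Lb : ℝ) ^ 2) ^ K := pow_le_pow_left₀ (by norm_num) (two_le_theta_mul_sq Lb h81) K
  have hmain : LW⁻¹ * (K : ℝ) ≤ 16 * cδ := by
    have e1 : gsz K = LW⁻¹ * (LW⁻¹) ^ K / 16 := by rw [gsz_eq, pow_succ]; ring
    have e2 : LW⁻¹ * (K : ℝ) * (((Lb : ℝ) ^ 2)⁻¹) ^ K ≤ LW⁻¹ * (LW⁻¹) ^ K := by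
      calc LW⁻¹ * (K : ℝ) * (((Lb : ℝ) ^ 2)⁻¹) ^ K ≤ LW⁻¹ * (LW⁻¹ * (Lb : ℝ) ^ 2) ^ K * (((Lb : ℝ) ^ 2)⁻¹) ^ K :=
            mul_le_mul_of_nonneg_right (mul_le_mul_of_nonneg_left h2K hθ.le) hψL.le
        _ = LW⁻¹ * (LW⁻¹) ^ K := by rw [mul_assoc, hprod]
    have e3 : LW⁻¹ * (LW⁻¹) ^ K ≤ 16 * cδ * (((Lb : ℝ) ^ 2)⁻¹) ^ K := by
      have := hge.trans hle
      rw [e1] at this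
      linarith
    exact le_of_mul_le_mul_right (e2.trans e3) hψL
  have : (K : ℝ) ≤ 16 * cδ / LW⁻¹ := by rw [le_div_iff₀ hθ]; linarith
  linarith

end Separation

end Summit.QuantumFields.BalabanUV.T4Continuum.NE1p.DressedTowerWitnessGauge

end
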